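import Summits.SmoothPoincare4.SmoothPoincare4.Theses.EntropyRung
import Literature.Geometry.Lorentzian.VolumeChartIntegral
import Literature.Geometry.Lorentzian.VolumeChartFormula
import Literature.Geometry.Lorentzian.VolumeProofs
import Literature.Geometry.Riemannian.RiemannianDistance
import HarnessLib

/-!
# Integration over a flat chart ball: `∫_{φ⁻¹ B̄} F dV_g = ∫_{B̄} F(φ⁻¹ y) dy`
(stub `stub_setIntegralFlatChart`, Stub S0b of line `green-blowup-conformal-entropy`, crux
`EntropyRung.SubcylindricalExistence`, item stmt-SmoothPoincare4-10871)

For a smooth Riemannian metric `g` on a smooth `4`-manifold of the summit binder (model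
`ℝ⁴ = EuclideanSpace ℝ (Fin 4)`, `I = 𝓡 4`), a point `p` with extended chart
`φ = extChartAt (𝓡 4) p`, and a closed ball `B̄ = closedBall (φ p) r ⊆ φ.target` on which the
inverse chart is a `g`-isometry — `g(dφ⁻¹_y X, dφ⁻¹_y W) = ⟪X, W⟫` for `y ∈ B̄` — the Riemannian
measure `dV_g` (`riemannianMeasure`, `Lorentzian/Volume.lean`) read in the chart over `B̄` is
Lebesgue measure: for every continuous `F : M → ℝ`,

  `∫_{φ.source ∩ φ⁻¹ B̄} F dV_g = ∫_{B̄} F(φ⁻¹ y) dy`.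

Proof: the chart formula for Bochner integrals `∫_{φ.source} G(φ x) dV_g = ∫_{φ.target} √det(g_{ij}) • G`
(`setIntegral_extChartAt_comp`, `Lorentzian/VolumeChartIntegral.lean`; Chavel 2006, §III.3,
(III.3.6)) applied to `G = 𝟙_{B̄} · (F ∘ φ⁻¹)`, together with the computation of the Gram matrix
`g_{ij}(y) = g(∂ᵢ, ∂ⱼ) = ⟪eᵢ, eⱼ⟫ = δ_{ij}` on `B̄` (flatness), so that `√det(g_{ij}) = 1` there.
Everything is proved; no definition, no named fact.

References: I. Chavel, *Riemannian Geometry: A Modern Introduction*, 2nd ed. (2006), §III.3,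
(III.3.5)–(III.3.6) [Chavel2006]; J. M. Lee, *Introduction to Riemannian Manifolds*, 2nd ed.
(2018), Prop. 2.41 ff. [Lee2018].
-/

noncomputable section

-- the registered namespace `Summit.SmoothPoincare4.SmoothPoincare4.Theorems` repeats a component
set_option linter.dupNamespace false

open scoped Manifold ContDiff Topology ENNReal NNReal RealInnerProductSpace
open Set Filter MeasureTheory
open Literature.Geometry.Lorentzian Literature.Geometry.Riemannian

namespace Summit.SmoothPoincare4.SmoothPoincare4.Theorems

namespace SetIntegralFlatChart

variable {M : Type*} [TopologicalSpace M] [ChartedSpace (EuclideanSpace ℝ (Fin 4)) M]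
  [IsManifold (𝓡 4) ∞ M]
  (g : PseudoRiemannianMetric (𝓡 4) ∞ (EuclideanSpace ℝ (Fin 4)) (TangentSpace (𝓡 4) : M → Type _))
  (hg : g.IsRiemannian) (p : M)

/-- **The Gram matrix of `g` at a flat point of the chart is the identity**: if
`g(dφ⁻¹_y X, dφ⁻¹_y W) = ⟪X, W⟫` for all `X, W` (`φ = extChartAt (𝓡 4) p`), then
`g_{ij}(y) = g(∂ᵢ, ∂ⱼ) = δ_{ij}`, i.e. `chartGramMatrix (g.toContMDiffRiemannianMetric hg) p y = 1`
(for the boundaryless model `𝓡 4` the coordinate vectors `∂ᵢ = D(φ⁻¹)(y) eᵢ` of `chartGramMatrix`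
are the `mfderiv`s of the hypothesis). [folklore] -/
theorem chartGramMatrix_eq_one_of_flat {y : EuclideanSpace ℝ (Fin 4)}
    (hflat : ∀ X W : EuclideanSpace ℝ (Fin 4),
        g.val ((extChartAt (𝓡 4) p).symm y)
          (mfderiv 𝓘(ℝ, EuclideanSpace ℝ (Fin 4)) (𝓡 4) (extChartAt (𝓡 4) p).symm y X)
          (mfderiv 𝓘(ℝ, EuclideanSpace ℝ (Fin 4)) (𝓡 4) (extChartAt (𝓡 4) p).symm y W) = ⟪X, W⟫) :
    chartGramMatrix (g.toContMDiffRiemannianMetric hg) p y = 1 := by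
  ext i j
  simp only [chartGramMatrix, Matrix.of_apply,
    PseudoRiemannianMetric.toContMDiffRiemannianMetric_inner]
  have hrange : range (𝓡 4) = univ := (𝓡 4).range_eq_univ
  rw [hrange, mfderivWithin_univ, hflat, Matrix.one_apply, EuclideanSpace.inner_single_left,
    PiLp.single_apply]
  simp only [map_one, one_mul]

/-- Hence **the Riemannian density is `1` at a flat point**: `√det(g_{ij}(y)) = 1`.
[folklore] -/
theorem sqrt_det_chartGramMatrix_eq_one_of_flat {y : EuclideanSpace ℝ (Fin 4)}
    (hflat : ∀ X W : EuclideanSpace ℝ (Fin 4),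
        g.val ((extChartAt (𝓡 4) p).symm y)
          (mfderiv 𝓘(ℝ, EuclideanSpace ℝ (Fin 4)) (𝓡 4) (extChartAt (𝓡 4) p).symm y X)
          (mfderiv 𝓘(ℝ, EuclideanSpace ℝ (Fin 4)) (𝓡 4) (extChartAt (𝓡 4) p).symm y W) = ⟪X, W⟫) :
    Real.sqrt (chartGramMatrix (g.toContMDiffRiemannianMetric hg) p y).det = 1 := by
  rw [chartGramMatrix_eq_one_of_flat g hg p hflat, Matrix.det_one, Real.sqrt_one]

variable [T3Space M] [MeasurableSpace M] [BorelSpace M]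

/-- **Integration over a flat chart ball** (workhorse form of the stub, named hypotheses): if the
closed ball `B̄ = closedBall (φ p) r` lies in `φ.target` (`φ = extChartAt (𝓡 4) p`) and `φ⁻¹` is a
`g`-isometry on `B̄`, then for every continuous `F : M → ℝ`,
`∫_{φ.source ∩ φ⁻¹ B̄} F dV_g = ∫_{B̄} F(φ⁻¹ y) dy` — the chart formula
`∫_{φ.source} G(φ x) dV_g = ∫_{φ.target} √det(g_{ij}) • G` (Chavel 2006, (III.3.6)) for
`G = 𝟙_{B̄} (F ∘ φ⁻¹)`, with `√det(g_{ij}) = 1` on `B̄`. [cite: Chavel2006, §III.3 (III.3.6)] -/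
theorem setIntegral_flatChart {r : ℝ}
    (hB : Metric.closedBall (extChartAt (𝓡 4) p p) r ⊆ (extChartAt (𝓡 4) p).target)
    (hflat : ∀ y ∈ Metric.closedBall (extChartAt (𝓡 4) p p) r, ∀ X W : EuclideanSpace ℝ (Fin 4),
        g.val ((extChartAt (𝓡 4) p).symm y)
          (mfderiv 𝓘(ℝ, EuclideanSpace ℝ (Fin 4)) (𝓡 4) (extChartAt (𝓡 4) p).symm y X)
          (mfderiv 𝓘(ℝ, EuclideanSpace ℝ (Fin 4)) (𝓡 4) (extChartAt (𝓡 4) p).symm y W) = ⟪X, W⟫)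
    {F : M → ℝ} (hF : Continuous F) :
    ∫ x in {x | x ∈ (extChartAt (𝓡 4) p).source ∧
        extChartAt (𝓡 4) p x ∈ Metric.closedBall (extChartAt (𝓡 4) p p) r}, F x
        ∂(riemannianMeasure (g.toContMDiffRiemannianMetric hg)) =
      ∫ y in Metric.closedBall (extChartAt (𝓡 4) p p) r, F ((extChartAt (𝓡 4) p).symm y) := by
  set φ := extChartAt (𝓡 4) p with hφ
  set B := Metric.closedBall (φ p) r with hBdef
  set G₀ := g.toContMDiffRiemannianMetric hg with hG₀
  set μ : Measure M := riemannianMeasure G₀ with hμ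
  have hsrc : MeasurableSet φ.source := (isOpen_extChartAt_source p).measurableSet
  have hBm : MeasurableSet B := Metric.isClosed_closedBall.measurableSet
  have hSm : MeasurableSet (φ.source ∩ φ ⁻¹' B) :=
    measurableSet_source_inter_preimage_extChartAt (I := 𝓡 4) p hBm
  have hS : {x | x ∈ φ.source ∧ φ x ∈ B} = φ.source ∩ (φ.source ∩ φ ⁻¹' B) := by
    rw [← inter_assoc, inter_self]
    rfl
  -- the chart representative `G = 𝟙_B (F ∘ φ⁻¹)`
  set G : EuclideanSpace ℝ (Fin 4) → ℝ := B.indicator (fun y ↦ F (φ.symm y)) with hGdef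
  have hcont : ContinuousOn (fun y ↦ F (φ.symm y)) φ.target :=
    hF.comp_continuousOn (continuousOn_extChartAt_symm (I := 𝓡 4) p)
  have hGm : AEStronglyMeasurable G
      ((volume : Measure (EuclideanSpace ℝ (Fin 4))).restrict φ.target) :=
    (hcont.aestronglyMeasurable (measurableSet_extChartAt_target (I := 𝓡 4) p)).indicator hBm
  -- the density is `1` on `B`
  have hdens : ∀ y ∈ B, Real.sqrt (chartGramMatrix G₀ p y).det = 1 := fun y hy ↦
    sqrt_det_chartGramMatrix_eq_one_of_flat g hg p (hflat y hy)
  calc ∫ x in {x | x ∈ φ.source ∧ φ x ∈ B}, F x ∂μ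
      = ∫ x in φ.source ∩ (φ.source ∩ φ ⁻¹' B), F x ∂μ := by rw [hS]
    _ = ∫ x in φ.source, (φ.source ∩ φ ⁻¹' B).indicator F x ∂μ := (setIntegral_indicator hSm).symm
    _ = ∫ x in φ.source, G (φ x) ∂μ := by
        refine setIntegral_congr_fun hsrc (fun x hx ↦ ?_)
        by_cases hxB : φ x ∈ B
        · have h1 : x ∈ φ.source ∩ φ ⁻¹' B := ⟨hx, hxB⟩
          rw [indicator_of_mem h1, hGdef, indicator_of_mem hxB, φ.left_inv hx]
        · have h1 : x ∉ φ.source ∩ φ ⁻¹' B := fun h ↦ hxB h.2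
          rw [indicator_of_notMem h1, hGdef, indicator_of_notMem hxB]
    _ = ∫ y in φ.target, Real.sqrt (chartGramMatrix G₀ p y).det • G y :=
        setIntegral_extChartAt_comp G₀ p hGm
    _ = ∫ y in φ.target,
          B.indicator (fun y ↦ Real.sqrt (chartGramMatrix G₀ p y).det • F (φ.symm y)) y := by
        refine setIntegral_congr_fun (measurableSet_extChartAt_target (I := 𝓡 4) p) (fun y _ ↦ ?_)
        rw [hGdef, indicator_smul_apply]
    _ = ∫ y in φ.target ∩ B, Real.sqrt (chartGramMatrix G₀ p y).det • F (φ.symm y) :=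
        setIntegral_indicator hBm
    _ = ∫ y in B, Real.sqrt (chartGramMatrix G₀ p y).det • F (φ.symm y) := by
        rw [inter_eq_right.2 hB]
    _ = ∫ y in B, F (φ.symm y) := by
        refine setIntegral_congr_fun hBm (fun y hy ↦ ?_)
        rw [hdens y hy, one_smul]

end SetIntegralFlatChart

/-- **Stub S0b — integration over a flat chart ball** (registered stub `stub_setIntegralFlatChart`
of line `green-blowup-conformal-entropy`): if `φ⁻¹` is a `g`-isometry on the closed ball
`B̄(y₀, r) ⊆ φ.target` (`φ = extChartAt (𝓡 4) p`, `y₀ = φ p`), then for every continuous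
`F : M → ℝ`, `∫_{φ⁻¹ B̄} F dV_g = ∫_{B̄(y₀, r)} F(φ⁻¹ y) dy` (Lebesgue measure of
`EuclideanSpace ℝ (Fin 4)`): the chart formula `dV_g = √det(g_{ij}) dy`
(`setIntegral_extChartAt_comp`) with `g_{ij} = δ_{ij}` on the ball. The hypotheses `0 < r` and
`[g.HasLeviCivita]` are not used. [cite: Chavel2006, §III.3 (III.3.6)] -/
theorem stub_setIntegralFlatChart :
    ∀ (M : Type) [TopologicalSpace M] [T2Space M] [SecondCountableTopology M]
      [ChartedSpace (EuclideanSpace ℝ (Fin 4)) M] [IsManifold (𝓡 4) ∞ M] [CompactSpace M]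
      [T3Space M] [MeasurableSpace M] [BorelSpace M]
      (g : PseudoRiemannianMetric (𝓡 4) ∞ (EuclideanSpace ℝ (Fin 4)) (TangentSpace (𝓡 4) : M → Type _))
      [g.HasLeviCivita] (hg : g.IsRiemannian) (p : M) (r : ℝ), 0 < r →
      Metric.closedBall (extChartAt (𝓡 4) p p) r ⊆ (extChartAt (𝓡 4) p).target →
      (∀ y ∈ Metric.closedBall (extChartAt (𝓡 4) p p) r, ∀ X W : EuclideanSpace ℝ (Fin 4),
        g.val ((extChartAt (𝓡 4) p).symm y)
          (mfderiv 𝓘(ℝ, EuclideanSpace ℝ (Fin 4)) (𝓡 4) (extChartAt (𝓡 4) p).symm y X)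
          (mfderiv 𝓘(ℝ, EuclideanSpace ℝ (Fin 4)) (𝓡 4) (extChartAt (𝓡 4) p).symm y W) = ⟪X, W⟫) →
      ∀ F : M → ℝ, Continuous F →
        ∫ x in {x | x ∈ (extChartAt (𝓡 4) p).source ∧
            extChartAt (𝓡 4) p x ∈ Metric.closedBall (extChartAt (𝓡 4) p p) r}, F x
            ∂(riemannianMeasure (g.toContMDiffRiemannianMetric hg)) =
          ∫ y in Metric.closedBall (extChartAt (𝓡 4) p p) r, F ((extChartAt (𝓡 4) p).symm y) := by
  intro M _ _ _ _ _ _ _ _ _ g _ hg p r _ hB hflat F hF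
  exact SetIntegralFlatChart.setIntegral_flatChart g hg p hB hflat hF

end Summit.SmoothPoincare4.SmoothPoincare4.Theorems

end
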